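import Mathlib
import Summits.KontsevichZagierPeriods.KontsevichZagierPeriods.Theorems.SoloInformedLocSplitTheta
import Summits.KontsevichZagierPeriods.KontsevichZagierPeriods.Theorems.SoloInformedPiDisc
import Summits.KontsevichZagierPeriods.KontsevichZagierPeriods.Theorems.SoloInformedTorsionFree
import HarnessLib
import HarnessLib.Audit

/-!
# SoloInformed — `θ₀ = 2·⟦[π]⟧`: the residual at `θ₀` IS `KZ.PiCancellation`

The class `soloInformedThetaClass = ⟦Ψ[h₀]⟧ = ⟦[[0,1], 8/((t−1)²+1)]⟧` (value `2π`) at which the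
programme's transfer theorem is normalised (`SoloInformedPiSat`, `SoloInformedLocSplitTheta`) and
the class `⟦[π]⟧ = ⟦[{x²+y²≤1}, 1]⟧` of the Literature statement `KZ.PiCancellation` were so far
only known to have proportional VALUES.  Using `SoloInformedPiDisc` (`[disc] ∼ 4·[[0,1], 1/(1+t²)]`
inside the four-move calculus) and one reflection `t ↦ 1 − t`, this file identifies the CLASSES:

* `soloInformed_psiRep_thetaIm_sub_two_nsmul_piRep_mem_relations` :
  `of Ψ[h₀] - 2 • of piRep ∈ KZ.relations`, i.e. `soloInformed_thetaClass_eq_two_mul_pi` :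
  `θ₀ = 2·⟦[π]⟧` in the formal period ring `P`;

and, `2` being a unit of `P` (`SoloInformedTorsionFree`), removes every trace of the auxiliary
normalisation from the programme's statements — with NO hypotheses:

* `soloInformed_piSatTheta_iff_piCancellation` : `SoloInformedPiSatTheta ↔ KZ.PiCancellation`;
* `soloInformed_kzLocTheta_iff_kzLocPi` : the period conjecture localised at `θ₀` is the period
  conjecture localised at `⟦[π]⟧` (Kontsevich–Zagier's `P̂ = P[1/π]`, [KZ 2001, §4.1]);
* `soloInformed_kzp_iff_piCancellation` : granting separation of poles, Nash cubulation and
  Ayoub's conjecture localised at `θ₀`, **KZP ⟺ `KZ.PiCancellation`** — the summit is equivalent to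
  the Literature's own one-line cancellation statement "`[π]·c ∈ relations → c ∈ relations`".

Residency `solo-KontsevichZagierPeriods-informed` (PLAN.md, session s15).
References: M. Kontsevich, D. Zagier, *Periods* (2001), §1.1, §1.2, §4.1; J. Ayoub, *Une version
relative de la conjecture des périodes de Kontsevich–Zagier*, Ann. Math. 181 (2015), Def. 10.
-/

noncomputable section

open MeasureTheory Set

namespace Summit.KontsevichZagierPeriods.KontsevichZagierPeriods.Theorems

open Literature.NumberTheory.Transcendental Literature.NumberTheory.Transcendental.KZ

/-! ### `Ψ[h₀] ∼ 8·[[0,1], 1/(1+t²)] ∼ 2·[disc]` -/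

/-- `[0,1]¹` is the unit interval of `SoloInformedKZStokesCells`. -/
theorem soloInformedCube_one_eq_unitI : soloInformedCube 1 = soloInformedUnitI := by
  ext x
  simp only [soloInformed_mem_cube_iff, Fin.forall_fin_one]
  rfl

/-- The integrand of `Ψ[h₀]` on real points: `Re h₀(t) = 8/((t−1)²+1)`. -/
theorem soloInformed_thetaIm_re (x : Fin 1 → ℝ) :
    (soloInformedThetaIm.f (soloInformedToC 1 x)).re = 8 / ((x 0 - 1) ^ 2 + 1) := by
  have h : soloInformedThetaIm.f (soloInformedToC 1 x) = ((8 / ((x 0 - 1) ^ 2 + 1) : ℝ) : ℂ) := by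
    rw [soloInformedThetaIm_f, soloInformedToC_apply]
    push_cast
    rfl
  rw [h, Complex.ofReal_re]

/-- Rule (2), the reflection `t ↦ 1 − t`: `Ψ[h₀] = [[0,1], 8/((t−1)²+1)] ∼ [[0,1], 8/(1+t²)]`. -/
theorem soloInformed_psiRep_thetaIm_sub_constMul_arctanRep_mem_relations :
    of (soloInformedAyoubPsiRep soloInformed_ayoubLemmaQ soloInformedThetaIm) -
      of (soloInformedArctanRep.constMul ((8 : ℕ) : ℝ) (isAlgebraic_nat 8)) ∈ relations :=
  soloInformed_of_sub_of_reflect_mem_relations _ _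
    (by rw [soloInformedAyoubPsiRep_domain, soloInformedCube_one_eq_unitI])
    (by rw [IntegralRep.domain_constMul, soloInformedArctanRep_domain])
    fun x _ => by
      simp only [soloInformedAyoubPsiRep_integrand, IntegralRep.integrand_constMul,
        soloInformedArctanRep_integrand, soloInformed_thetaIm_re, Nat.cast_ofNat]
      rw [show (1 : ℝ) + (1 - x 0) ^ 2 = (x 0 - 1) ^ 2 + 1 by ring, mul_one_div]

/-- `Ψ[h₀] ∼ 8·[[0,1], 1/(1+t²)]`: `of Ψ[h₀] - 8 • of [[0,1], 1/(1+t²)] ∈ relations`. -/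
theorem soloInformed_psiRep_thetaIm_sub_eight_nsmul_arctanRep_mem_relations :
    of (soloInformedAyoubPsiRep soloInformed_ayoubLemmaQ soloInformedThetaIm) -
      8 • of soloInformedArctanRep ∈ relations := by
  have h1 := soloInformed_psiRep_thetaIm_sub_constMul_arctanRep_mem_relations
  have h2 := soloInformedArctanRep.of_constMul_nat_sub_nsmul_mem_relations 8
  have e : of (soloInformedAyoubPsiRep soloInformed_ayoubLemmaQ soloInformedThetaIm) -
      8 • of soloInformedArctanRep =
      (of (soloInformedAyoubPsiRep soloInformed_ayoubLemmaQ soloInformedThetaIm) -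
        of (soloInformedArctanRep.constMul ((8 : ℕ) : ℝ) (isAlgebraic_nat 8))) +
      (of (soloInformedArctanRep.constMul ((8 : ℕ) : ℝ) (isAlgebraic_nat 8)) -
        8 • of soloInformedArctanRep) := by abel
  rw [e]
  exact relations.add_mem h1 h2

/-- **`Ψ[h₀] ∼ 2·[disc, 1]` inside the four-move calculus**:
`of Ψ[h₀] - 2 • of piRep ∈ KZ.relations`. -/
theorem soloInformed_psiRep_thetaIm_sub_two_nsmul_piRep_mem_relations :
    of (soloInformedAyoubPsiRep soloInformed_ayoubLemmaQ soloInformedThetaIm) - 2 • of piRep ∈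
      relations := by
  have h1 := soloInformed_psiRep_thetaIm_sub_eight_nsmul_arctanRep_mem_relations
  have h2 := soloInformed_piRep_sub_four_nsmul_arctanRep_mem_relations
  have e : of (soloInformedAyoubPsiRep soloInformed_ayoubLemmaQ soloInformedThetaIm) -
      2 • of piRep =
      (of (soloInformedAyoubPsiRep soloInformed_ayoubLemmaQ soloInformedThetaIm) -
        8 • of soloInformedArctanRep) - 2 • (of piRep - 4 • of soloInformedArctanRep) := by
    rw [nsmul_sub, ← mul_nsmul]
    abel
  rw [e]
  exact relations.sub_mem h1 (relations.nsmul_mem h2 2)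

/-- `Ψ[h₀]` and `2·[disc, 1]` are KZ-equivalent: an effective instance of the period conjecture
for the pair of representations `∫₀¹ 8 dt/((t−1)²+1) = 2π = ∬_{x²+y²≤1} 2 dx dy`. -/
theorem soloInformed_psiRep_thetaIm_equivalent_constMul_piRep :
    Equivalent (soloInformedAyoubPsiRep soloInformed_ayoubLemmaQ soloInformedThetaIm)
      (piRep.constMul ((2 : ℕ) : ℝ) (isAlgebraic_nat 2)) := by
  have h := piRep.of_constMul_nat_sub_nsmul_mem_relations 2
  have e : of (soloInformedAyoubPsiRep soloInformed_ayoubLemmaQ soloInformedThetaIm) -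
      of (piRep.constMul ((2 : ℕ) : ℝ) (isAlgebraic_nat 2)) =
      (of (soloInformedAyoubPsiRep soloInformed_ayoubLemmaQ soloInformedThetaIm) - 2 • of piRep) -
        (of (piRep.constMul ((2 : ℕ) : ℝ) (isAlgebraic_nat 2)) - 2 • of piRep) := by abel
  show of _ - of _ ∈ relations
  rw [e]
  exact relations.sub_mem soloInformed_psiRep_thetaIm_sub_two_nsmul_piRep_mem_relations h

/-! ### `θ₀ = 2·⟦[π]⟧` in `P` -/

/-- **THEOREM (`θ₀ = 2·⟦[π]⟧`).** The class of `Ψ[h₀]` in the formal period ring is twice the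
class of the disc representation `KZ.piRep`. -/
theorem soloInformed_thetaClass_eq_two_mul_pi :
    soloInformedThetaClass = 2 * toFormalPeriod (of piRep) := by
  have h := soloInformed_psiRep_thetaIm_sub_two_nsmul_piRep_mem_relations
  rw [← toFormalPeriod_eq_zero_iff, map_sub, map_nsmul, sub_eq_zero] at h
  rw [soloInformedThetaClass, soloInformedAyoubPsi_of, h, nsmul_eq_mul, Nat.cast_ofNat]

/-- `2` is a unit of the formal period ring (`SoloInformedTorsionFree`). -/
theorem soloInformed_isUnit_two : IsUnit (2 : FormalPeriodRing) := by
  have h := soloInformed_isUnit_natCast (n := 2) two_ne_zero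
  rwa [Nat.cast_ofNat] at h

/-! ### Consequences with no hypotheses -/

/-- **THEOREM (the residual at `θ₀` is `KZ.PiCancellation`; no hypotheses).**
`SoloInformedPiSatTheta ↔ KZ.PiCancellation`: "`⟦2π⟧ = θ₀` cancels in `P`" iff "`⟦[π]⟧` cancels
in `P`", since `θ₀ = 2·⟦[π]⟧` and `2 ∈ Pˣ`. -/
theorem soloInformed_piSatTheta_iff_piCancellation : SoloInformedPiSatTheta ↔ PiCancellation := by
  rw [soloInformed_piSatTheta_iff_cancel, soloInformed_piCancellation_iff_cancel,
    soloInformed_thetaClass_eq_two_mul_pi]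
  refine forall_congr' fun q => ?_
  rw [mul_assoc, soloInformed_isUnit_two.mul_right_eq_zero]

/-- **THEOREM (one localised conjecture; no hypotheses).** The period conjecture localised at
`θ₀` is the period conjecture localised at `⟦[π]⟧`: `P[θ₀⁻¹] = P[⟦π⟧⁻¹]` is Kontsevich–Zagier's
`P̂ = P[1/π]` up to the unit `2`. [Kontsevich–Zagier 2001, §4.1] -/
theorem soloInformed_kzLocTheta_iff_kzLocPi :
    SoloInformedKZLocTheta ↔
      SoloInformedKZLocAt (toFormalPeriod (of piRep)) soloInformed_evalP_piRep_ne_zero := by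
  unfold SoloInformedKZLocTheta
  rw [soloInformed_kzLocAt_iff, soloInformed_kzLocAt_iff]
  refine forall_congr' fun x => forall_congr' fun y => imp_congr_right fun _ =>
    exists_congr fun n => ?_
  rw [soloInformed_thetaClass_eq_two_mul_pi, mul_pow, mul_assoc, mul_assoc,
    (soloInformed_isUnit_two.pow n).mul_right_inj]

/-! ### The transfer theorem lands on `KZ.PiCancellation` -/

/-- **THEOREM IV (final form).** Granting separation of poles [van den Dries–Speissegger], Nash
cubulation and Ayoub's conjecture on symbols localised at `θ₀`, **the Kontsevich–Zagier period
conjecture is equivalent to `KZ.PiCancellation`**: "if `[π]·c` is a `ℤ`-combination of the four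
moves then so is `c`". -/
theorem soloInformed_kzp_iff_piCancellation (H₂ : SoloInformedSeparationOfPoles)
    (hN : SoloInformedNashCubulation) (hI : SoloInformedAyoubEvInjLocTheta) :
    KontsevichZagierPeriods ↔ PiCancellation :=
  (soloInformed_kzp_iff_piSatTheta H₂ hN hI).trans soloInformed_piSatTheta_iff_piCancellation

/-- The transfer direction alone: under the three hypotheses, `KZ.PiCancellation → KZP`. -/
theorem soloInformed_kzp_of_piCancellation (H₂ : SoloInformedSeparationOfPoles)
    (hN : SoloInformedNashCubulation) (hI : SoloInformedAyoubEvInjLocTheta)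
    (hc : PiCancellation) : KontsevichZagierPeriods :=
  (soloInformed_kzp_iff_piCancellation H₂ hN hI).2 hc

end Summit.KontsevichZagierPeriods.KontsevichZagierPeriods.Theorems
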